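import Summits.NavierStokesRegularity.NavierStokesRegularity.Theses.TypeIQuarterGate
import Summits.NavierStokesRegularity.NavierStokesRegularity.Theorems.TypeIQuarterGateLorentzAmplitudeEnergyLaw
import Summits.NavierStokesRegularity.NavierStokesRegularity.Theorems.TypeIQuarterGateLorentzCeilingSparsityByName
import HarnessLib

/-!
# `TypeIQuarterGate`: NEAR-CEILING ENERGY DECAY — the Lorentz Type-I bound ⟺ the kinetic energy above
# each fixed fraction of the Type-I ceiling is `O(√(T−t))`
# (crux `QuarterLawTypeI`, stmt-NavierStokesRegularity-23726; open stub `stub_lorentzUpgrade` = item 24108)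

`--supports stmt-NavierStokesRegularity-23726` (helper, def-free).  Combines the two landed dictionaries
of this line — the level-truncated energies (`LorentzAmplitude.*`, file
`TypeIQuarterGateLorentzAmplitudeEnergyLaw.lean`) and near-ceiling sparsity (`LorentzCeiling.*`, files
`TypeIQuarterGateLorentzCeilingSparsity{,ByName}.lean`) — into the ENERGY form of the open estimate:
along a sup-norm Type-I maximal classical Leray–Hopf blow-up from a rapidly decaying datum,

  NEAR-CEILING ENERGY DECAY:  for every fraction `κ > 0` there are `C, t₁ < T` with
  `∫_{‖u(t)‖ > κ/√(T−t)} ‖u(t)‖² ≤ C √(T−t)` for all `t ∈ [t₁, T)`.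

* `ceilingEnergyDecay_of_lorentzBound` — the uniform weak-`L³` bound gives it (layer cake at the level
  `κ/√(T−t)`: `λ E_{>λ} ≤ 3W`);
* `ceilingSparsity_of_ceilingEnergyDecay` — it gives near-ceiling sparsity (Chebyshev on the superlevel
  set: `λ³|{λ<‖u‖}| ≤ λ E_{>λ} ≤ κ C`);
* `lorentzBound_of_ceilingEnergyDecay` — hence (tree chain through the ε-count) the FULL weak-`L³`
  bound; BY NAME `lorentzUpgradeTypeI_iff_ceilingEnergyDecay`, `quarterLawTypeI_iff_ceilingEnergyDecay`.

Reading.  The Leray–Hopf energy bounds `∫_{‖u‖>κ/√(T−t)}‖u‖² ≤ 2E(u₀)` with NO decay; 24108 asks that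
the energy carried by the amplitudes within a fixed factor of the Type-I ceiling VANISH at the
self-similar rate `√(T−t)` = (one parabolic cell `(T−t)^{3/2}`) × (ceiling amplitude `(T−t)^{-1/2}`)².
A single Leray self-similar profile `u = (T−t)^{-1/2} U(x/√(T−t))` with `U ∈ L^{3,∞}` has exactly this
rate; the NSI Type-I cascade (docstring of `LorentzUpgradeTypeI`) violates it.  So the NSE-only input a
proof must supply is an ENERGY-FLUX statement: energy cannot accumulate in the near-ceiling region
faster than the self-similar rate.

HONEST FRAMING: reformulations along a HYPOTHETICAL blow-up; `LorentzUpgradeTypeI` (24108) and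
`QuarterLawTypeI` (23726) remain OPEN; nothing about Navier–Stokes regularity or blow-up is claimed and
no summit statement is proved. [folklore]
-/

noncomputable section

-- the summit-side namespace repeats a component by design (D-0017)
set_option linter.dupNamespace false

namespace Summit.NavierStokesRegularity.NavierStokesRegularity.Theorems.LorentzCeiling

open Set MeasureTheory Function Metric Filter Topology
open scoped ENNReal NNReal
open Literature.Analysis.FluidPDE Literature.Analysis.FunctionSpaces
open Summit.NavierStokesRegularity.NavierStokesRegularity.Theorems.LorentzAmplitude

variable {ν T : ℝ} {u : ℝ → EuclideanSpace ℝ (Fin 3) → EuclideanSpace ℝ (Fin 3)}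
  {p : ℝ → EuclideanSpace ℝ (Fin 3) → ℝ}

/-- **Uniform weak-`L³` bound ⟹ near-ceiling energy decay**: along a classical solution on `[0,T)`
with `sup_λ λ³|{λ<‖u(t)‖}| ≤ M'` on `[0,T)`, for every `κ > 0` and `t ∈ [0,T)`,
`∫_{‖u(t)‖>κ/√(T−t)} ‖u(t)‖² ≤ (3M'/κ) √(T−t)`. [folklore] -/
theorem ceilingEnergyDecay_of_lorentzBound (hT : 0 < T)
    (hsol : IsClassicalNSSolutionOn (Ico 0 T) ν 0 u p)
    (hW : ∃ M' : ℝ, ∀ t ∈ Ico 0 T, eWeakLpPow (u t) 3 volume ≤ ENNReal.ofReal M') :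
    ∀ κ : ℝ, 0 < κ → ∃ C t₁ : ℝ, t₁ < T ∧ ∀ t ∈ Ico t₁ T,
      ∫⁻ x in {x | κ / Real.sqrt (T - t) < ‖u t x‖}, ‖u t x‖ₑ ^ 2 ≤
        ENNReal.ofReal (C * Real.sqrt (T - t)) := by
  obtain ⟨M', hM'⟩ := hW
  intro κ hκ
  refine ⟨3 * max M' 0 / κ, 0, hT, fun t ht => ?_⟩
  have hTt : 0 < T - t := sub_pos.2 ht.2
  have hs : 0 < Real.sqrt (T - t) := Real.sqrt_pos.2 hTt
  set lam : ℝ := κ / Real.sqrt (T - t) with hlam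
  have hlampos : 0 < lam := div_pos hκ hs
  have hcont : Continuous (u t) := (hsol.contDiff_velocity ht).continuous
  have h3 := highAmplitudeEnergy_le_of_eWeakLpPow (μ := volume) hcont.aestronglyMeasurable hlampos
    (measurableSet_lt_norm_slice hsol ht lam)
  have h3' : ENNReal.ofReal lam * ∫⁻ x in {x | lam < ‖u t x‖}, ‖u t x‖ₑ ^ 2 ≤
      ENNReal.ofReal (3 * max M' 0) := by
    refine h3.trans ?_
    rw [ENNReal.ofReal_mul (by norm_num), ENNReal.ofReal_ofNat]
    exact mul_le_mul' le_rfl ((hM' t ht).trans (ENNReal.ofReal_le_ofReal (le_max_left _ _)))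
  -- divide by `λ`: `E ≤ 3M''/λ = (3M''/κ) √(T−t)`
  have hE : ∫⁻ x in {x | lam < ‖u t x‖}, ‖u t x‖ₑ ^ 2 ≤ ENNReal.ofReal (3 * max M' 0 / lam) := by
    have hlam_ne : ENNReal.ofReal lam ≠ 0 := (ENNReal.ofReal_pos.2 hlampos).ne'
    calc ∫⁻ x in {x | lam < ‖u t x‖}, ‖u t x‖ₑ ^ 2
        = (ENNReal.ofReal lam)⁻¹ * (ENNReal.ofReal lam * ∫⁻ x in {x | lam < ‖u t x‖}, ‖u t x‖ₑ ^ 2) := by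
          rw [← mul_assoc, ENNReal.inv_mul_cancel hlam_ne ENNReal.ofReal_ne_top, one_mul]
      _ ≤ (ENNReal.ofReal lam)⁻¹ * ENNReal.ofReal (3 * max M' 0) := mul_le_mul' le_rfl h3'
      _ = ENNReal.ofReal (3 * max M' 0 / lam) := by
          rw [← ENNReal.ofReal_inv_of_pos hlampos, ← ENNReal.ofReal_mul (inv_nonneg.2 hlampos.le),
            inv_mul_eq_div]
  refine hE.trans (le_of_eq ?_)
  congr 1
  rw [hlam]
  field_simp

/-- **Near-ceiling energy decay ⟹ near-ceiling sparsity** (Chebyshev on the superlevel set: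
`λ³|{λ<‖u(t)‖}| ≤ λ ∫_{λ<‖u(t)‖}‖u(t)‖² ≤ κ C` at `λ = κ/√(T−t)`), along a classical solution on
`[0,T)`, `T > 0`. [folklore] -/
theorem ceilingSparsity_of_ceilingEnergyDecay (hT : 0 < T)
    (hsol : IsClassicalNSSolutionOn (Ico 0 T) ν 0 u p)
    (hE : ∀ κ : ℝ, 0 < κ → ∃ C t₁ : ℝ, t₁ < T ∧ ∀ t ∈ Ico t₁ T,
      ∫⁻ x in {x | κ / Real.sqrt (T - t) < ‖u t x‖}, ‖u t x‖ₑ ^ 2 ≤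
        ENNReal.ofReal (C * Real.sqrt (T - t))) :
    ∀ κ : ℝ, 0 < κ → ∃ M t₁ : ℝ, t₁ < T ∧ ∀ t ∈ Ico t₁ T,
      ENNReal.ofReal ((κ / Real.sqrt (T - t)) ^ 3) *
        volume {x | κ / Real.sqrt (T - t) < ‖u t x‖} ≤ ENNReal.ofReal M := by
  intro κ hκ
  obtain ⟨C, t₁, ht₁T, hC⟩ := hE κ hκ
  refine ⟨κ * max C 0, max t₁ 0, max_lt ht₁T hT, fun t ht => ?_⟩
  have ht0 : 0 ≤ t := (le_max_right _ _).trans ht.1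
  have htI : t ∈ Ico 0 T := ⟨ht0, ht.2⟩
  have hTt : 0 < T - t := sub_pos.2 ht.2
  have hs : 0 < Real.sqrt (T - t) := Real.sqrt_pos.2 hTt
  set lam : ℝ := κ / Real.sqrt (T - t) with hlam
  have hlampos : 0 < lam := div_pos hκ hs
  have hcont : Continuous (u t) := (hsol.contDiff_velocity htI).continuous
  have hcheb := cube_mul_meas_lt_le_mul_setLIntegral (μ := volume) hcont.aestronglyMeasurable hlampos
  have hCt := hC t ⟨(le_max_left _ _).trans ht.1, ht.2⟩
  calc ENNReal.ofReal (lam ^ 3) * volume {x | lam < ‖u t x‖}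
      ≤ ENNReal.ofReal lam * ∫⁻ x in {x | lam < ‖u t x‖}, ‖u t x‖ₑ ^ 2 := hcheb
    _ ≤ ENNReal.ofReal lam * ENNReal.ofReal (max C 0 * Real.sqrt (T - t)) := by
        refine mul_le_mul' le_rfl (hCt.trans (ENNReal.ofReal_le_ofReal ?_))
        exact mul_le_mul_of_nonneg_right (le_max_left _ _) hs.le
    _ = ENNReal.ofReal (κ * max C 0) := by
        rw [← ENNReal.ofReal_mul hlampos.le]
        congr 1
        rw [hlam]
        field_simp

/-- **Near-ceiling energy decay ⟹ the FULL weak-`L³` bound**, along a maximal classical Leray–Hopf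
solution from a rapidly decaying datum with the sup-norm Type-I rate at `T` (via near-ceiling sparsity
and the tree chain `LorentzCeiling.lorentzBound_of_ceilingSparsity`). [cite: BarkerPrange2020, Thm 1] -/
theorem lorentzBound_of_ceilingEnergyDecay (hν : 0 < ν) (hT : 0 < T)
    (hmax : IsMaximalSmoothSolution ν 0 u p T) (hLH : IsLerayHopfOn T ν 0 (u 0) u)
    (hdec : HasRapidSpatialDecay (u 0)) (hI : IsTypeIBlowup u T)
    (hE : ∀ κ : ℝ, 0 < κ → ∃ C t₁ : ℝ, t₁ < T ∧ ∀ t ∈ Ico t₁ T,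
      ∫⁻ x in {x | κ / Real.sqrt (T - t) < ‖u t x‖}, ‖u t x‖ₑ ^ 2 ≤
        ENNReal.ofReal (C * Real.sqrt (T - t))) :
    ∃ M' : ℝ, ∀ t ∈ Ico 0 T, eWeakLpPow (u t) 3 volume ≤ ENNReal.ofReal M' :=
  lorentzBound_of_ceilingSparsity hν hT hmax hLH hdec hI
    (ceilingSparsity_of_ceilingEnergyDecay hT hmax.1 hE)

/-- **Per solution: uniform weak-`L³` bound ⟺ near-ceiling energy decay** along a sup-norm Type-I
maximal classical Leray–Hopf blow-up from a rapidly decaying datum. [folklore] -/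
theorem lorentzBound_iff_ceilingEnergyDecay (hν : 0 < ν) (hT : 0 < T)
    (hmax : IsMaximalSmoothSolution ν 0 u p T) (hLH : IsLerayHopfOn T ν 0 (u 0) u)
    (hdec : HasRapidSpatialDecay (u 0)) (hI : IsTypeIBlowup u T) :
    (∃ M' : ℝ, ∀ t ∈ Ico 0 T, eWeakLpPow (u t) 3 volume ≤ ENNReal.ofReal M') ↔
      ∀ κ : ℝ, 0 < κ → ∃ C t₁ : ℝ, t₁ < T ∧ ∀ t ∈ Ico t₁ T,
        ∫⁻ x in {x | κ / Real.sqrt (T - t) < ‖u t x‖}, ‖u t x‖ₑ ^ 2 ≤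
          ENNReal.ofReal (C * Real.sqrt (T - t)) :=
  ⟨ceilingEnergyDecay_of_lorentzBound hT hmax.1, lorentzBound_of_ceilingEnergyDecay hν hT hmax hLH hdec hI⟩

/-! ### BY NAME -/

open Summit.NavierStokesRegularity.NavierStokesRegularity.Theses.TypeIQuarterGate

/-- **BY NAME: `LorentzUpgradeTypeI` ⟺ NEAR-CEILING ENERGY DECAY.**  The open item 24108 is equivalent
to: along every sup-norm Type-I maximal classical Leray–Hopf blow-up from a rapidly decaying datum, for
every fraction `κ > 0` there are `C, t₁ < T` with `∫_{‖u(t)‖>κ/√(T−t)} ‖u(t)‖² ≤ C √(T−t)` on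
`[t₁,T)` — the kinetic energy above each fixed fraction of the Type-I ceiling vanishes at the
self-similar rate.  `LorentzUpgradeTypeI` remains OPEN. [folklore] -/
theorem lorentzUpgradeTypeI_iff_ceilingEnergyDecay :
    LorentzUpgradeTypeI ↔
      ∀ (ν T : ℝ), 0 < ν → 0 < T →
        ∀ (u : ℝ → EuclideanSpace ℝ (Fin 3) → EuclideanSpace ℝ (Fin 3))
          (p : ℝ → EuclideanSpace ℝ (Fin 3) → ℝ),
          IsMaximalSmoothSolution ν 0 u p T → IsLerayHopfOn T ν 0 (u 0) u →
          HasRapidSpatialDecay (u 0) → IsTypeIBlowup u T →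
          ∀ κ : ℝ, 0 < κ → ∃ C t₁ : ℝ, t₁ < T ∧ ∀ t ∈ Set.Ico t₁ T,
            ∫⁻ x in {x | κ / Real.sqrt (T - t) < ‖u t x‖}, ‖u t x‖ₑ ^ 2 ≤
              ENNReal.ofReal (C * Real.sqrt (T - t)) := by
  unfold LorentzUpgradeTypeI
  constructor
  · intro h ν T hν hT u p hmax hLH hdec hI
    exact ceilingEnergyDecay_of_lorentzBound hT hmax.1 (h ν T hν hT u p hmax hLH hdec hI)
  · intro h ν T hν hT u p hmax hLH hdec hI
    exact lorentzBound_of_ceilingEnergyDecay hν hT hmax hLH hdec hI (h ν T hν hT u p hmax hLH hdec hI)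

/-- **BY NAME: the crux `QuarterLawTypeI` ⟺ NEAR-CEILING ENERGY DECAY** along Type-I blow-ups (via the
tree's `LorentzOfEnvelope.lorentzUpgradeTypeI_iff_quarterLawTypeI`).  `QuarterLawTypeI` remains OPEN.
[folklore] -/
theorem quarterLawTypeI_iff_ceilingEnergyDecay :
    QuarterLawTypeI ↔
      ∀ (ν T : ℝ), 0 < ν → 0 < T →
        ∀ (u : ℝ → EuclideanSpace ℝ (Fin 3) → EuclideanSpace ℝ (Fin 3))
          (p : ℝ → EuclideanSpace ℝ (Fin 3) → ℝ),
          IsMaximalSmoothSolution ν 0 u p T → IsLerayHopfOn T ν 0 (u 0) u →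
          HasRapidSpatialDecay (u 0) → IsTypeIBlowup u T →
          ∀ κ : ℝ, 0 < κ → ∃ C t₁ : ℝ, t₁ < T ∧ ∀ t ∈ Set.Ico t₁ T,
            ∫⁻ x in {x | κ / Real.sqrt (T - t) < ‖u t x‖}, ‖u t x‖ₑ ^ 2 ≤
              ENNReal.ofReal (C * Real.sqrt (T - t)) :=
  LorentzOfEnvelope.lorentzUpgradeTypeI_iff_quarterLawTypeI.symm.trans
    lorentzUpgradeTypeI_iff_ceilingEnergyDecay

end Summit.NavierStokesRegularity.NavierStokesRegularity.Theorems.LorentzCeiling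

end
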